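import Literature.AnabelianGeometry.EtaleTheta.FrobenioidTheta

/-!
# [EtTh] §5: "`Ψ` preserves `O^×(−)`" from a 1-compatible `Ψ^bs`, and subgroup bookkeeping (pp. 328, 334 / PDF pp. 102, 108)

Mochizuki, *The étale theta function …*, Publ. RIMS **45** (2009)
[cite: MochizukiEtTh2009, Thm 5.6 p.328 (PDF p.102)].  Seat abc-iut-L2-d4 (wave-3 discharge; shared lemmas for the
nodes `EtTh:Thm5.6`, `EtTh:Thm5.10(i)(ii)(iii)`); PROOF-ONLY over abc-iut-L2-t4's `FrobenioidTheta.lean`.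

The proofs of Theorem 5.6 (p.328 (PDF p.102): "by Proposition 5.1; [FrdI], Theorem 3.4, (iv), (v), it follows that `Ψ`
preserves '`O^×(−)`' and induces a 1-compatible equivalence `Ψ^bs : D ⥲ D`") and of Theorem 5.10 (ii)
(p.334 (PDF p.108): "it follows from the existence of `Ψ^bs` … that `Ψ` preserves '`O^▹(−)`' … `O^×(B_N)`") use that a
self-equivalence `Ψ` of the Frobenioid `C` compatible with a self-equivalence `Ψ^bs` of the base `D`
carries base-identity automorphisms to base-identity automorphisms.  Here this is PROVED for the typed §5
data from a natural isomorphism `Ψ ⋙ Base ≅ Base ⋙ Ψ^bs` with `Ψ^bs` faithful (`units_map_mapAut`: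
`Ψ(O^×(S)) = O^×(Ψ(S))`), together with its consequences for the cyclotomes `μ_M(S)` and `μ_M`-saturation
(Def. 5.4 (a)), and elementary bookkeeping on subgroups stable under a group automorphism used throughout
the discharge files `Discharge/Sec5Thm5*.lean`.  HONEST FRAMING: kernel-checked statements about the typed
§5 data; typed ≠ discharged; no side taken on anything downstream. -/

namespace Literature.AnabelianGeometry.EtaleTheta

open CategoryTheory
open scoped Pointwise

universe w v v' u u'

namespace ThetaFrobenioid

/-! ### Subgroups stable under an automorphism (bookkeeping) -/

section Stable

variable {G : Type*} [Group G] {Φ : G ≃* G} {H : Subgroup G}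

/-- `Φ(H) = H` makes membership in `H` invariant under `Φ`. [cite: MochizukiEtTh2009, Thm 5.10 (ii) p.334 (PDF p.108)] -/
theorem mem_iff_of_map_equiv_eq (h : H.map Φ.toMonoidHom = H) (x : G) : Φ x ∈ H ↔ x ∈ H := by
  conv_lhs => rw [← h]
  rw [Subgroup.mem_map_equiv, MulEquiv.symm_apply_apply]

/-- `Φ(H) = H` implies `Φ⁻¹(H) = H`. [cite: MochizukiEtTh2009, Thm 5.10 (ii) p.334 (PDF p.108)] -/
theorem map_symm_eq_of_map_equiv_eq (h : H.map Φ.toMonoidHom = H) : H.map Φ.symm.toMonoidHom = H := by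
  ext x
  rw [Subgroup.mem_map_equiv, MulEquiv.symm_symm, mem_iff_of_map_equiv_eq h]

/-- `Φ(H) = H` implies `Φ(N(H)) ⊆ N(H)` (pointwise). [cite: MochizukiEtTh2009, Thm 5.10 (ii) p.334 (PDF p.108)] -/
theorem map_mem_normalizer_of_map_equiv_eq (h : H.map Φ.toMonoidHom = H) {n : G}
    (hn : n ∈ Subgroup.normalizer (H : Set G)) : Φ n ∈ Subgroup.normalizer (H : Set G) := by
  have : Φ n ∈ (Subgroup.normalizer (H : Set G)).map Φ.toMonoidHom := ⟨n, hn, rfl⟩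
  rwa [Subgroup.map_equiv_normalizer_eq, h] at this

/-- Conversely, `Φ`-invariance of membership gives `Φ(H) = H`. [cite: MochizukiEtTh2009, Thm 5.10 (ii) p.334 (PDF p.108)] -/
theorem map_equiv_eq_of_mem_iff (h : ∀ x, Φ x ∈ H ↔ x ∈ H) : H.map Φ.toMonoidHom = H := by
  ext y
  rw [Subgroup.mem_map_equiv, ← h (Φ.symm y), MulEquiv.apply_symm_apply]

/-- Membership criterion from `Θ(H) = δ · H · δ⁻¹`: `δ⁻¹ · Θ(x) · δ ∈ H ↔ x ∈ H`.
[cite: MochizukiEtTh2009, Thm 5.10 (ii) p.334 (PDF p.108)] -/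
theorem mem_iff_of_map_equiv_eq_conj_smul {δ : G} (h : H.map Φ.toMonoidHom = MulAut.conj δ • H) (x : G) :
    δ⁻¹ * Φ x * δ ∈ H ↔ x ∈ H := by
  have : Φ x ∈ H.map Φ.toMonoidHom ↔ x ∈ H := by
    rw [Subgroup.mem_map_equiv, MulEquiv.symm_apply_apply]
  rw [← this, h, Subgroup.mem_pointwise_smul_iff_inv_smul_mem, MulAut.smul_def, MulAut.conj_inv_apply]

/-- `Inn(g) · H = H` for `g` in the normaliser of `H`. [cite: MochizukiEtTh2009, Thm 5.10 (ii) p.334 (PDF p.108)] -/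
theorem conj_smul_eq_self_of_mem_normalizer {g : G} (hg : g ∈ Subgroup.normalizer (H : Set G)) :
    MulAut.conj g • H = H := by
  ext x
  rw [Subgroup.mem_pointwise_smul_iff_inv_smul_mem, MulAut.smul_def, MulAut.conj_inv_apply]
  exact (Subgroup.mem_normalizer_iff''.mp hg x).symm

end Stable

variable {C : Type u} [Category.{v} C] {D : Type u'} [Category.{v'} D] {𝔉 : ThetaFrobenioid.{w} C D}

/-! ### Isomorphisms, pre-steps, units ([FrdI] Rmk. 1.1.1, Def. 1.2) -/

/-- Units have trivial base automorphism: `u^bs = 1` for `u ∈ O^×(S)`. [cite: MochizukiEtTh2009, §5 p.331 (PDF p.105)] -/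
theorem base_map_units_aut {S : C} {u : Aut S} (hu : u ∈ 𝔉.units S) : 𝔉.autBase S u = 1 := by
  have := (𝔉.units_eq_ker S).le hu
  rwa [MonoidHom.mem_ker] at this

/-- Isomorphisms are linear: `deg_Fr(i) · deg_Fr(i⁻¹) = deg_Fr(id) = 1` ([FrdI] Rmk. 1.1.1).
[cite: MochizukiEtTh2009, Thm 5.10 (i) p.334 (PDF p.108)] -/
theorem isLinear_iso_hom {A A' : C} (i : A' ≅ A) : 𝔉.IsLinear i.hom := by
  have h := 𝔉.pre.degFr_comp i.hom i.inv
  rw [i.hom_inv_id, 𝔉.pre.degFr_id] at h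
  have h' : ((𝔉.pre.degFr i.hom : ℕ+) : ℕ) * (𝔉.pre.degFr i.inv : ℕ) = 1 := by exact_mod_cast h.symm
  exact PNat.coe_injective (Nat.eq_one_of_mul_eq_one_right h')

/-- Pre-steps are stable under precomposition with an isomorphism ([FrdI] Def. 1.2 (iii), Rmk. 1.1.1).
[cite: MochizukiEtTh2009, Thm 5.10 (i) p.334 (PDF p.108)] -/
theorem isPreStep_iso_hom_comp {A A' B : C} (i : A' ≅ A) {φ : A ⟶ B} (hφ : 𝔉.IsPreStep φ) :
    𝔉.IsPreStep (i.hom ≫ φ) := by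
  refine ⟨?_, ?_⟩
  · change 𝔉.pre.degFr (i.hom ≫ φ) = 1
    rw [𝔉.pre.degFr_comp, show 𝔉.pre.degFr φ = 1 from hφ.1, mul_one]
    exact isLinear_iso_hom i
  · change IsIso (𝔉.base.map (i.hom ≫ φ))
    haveI : IsIso (𝔉.base.map φ) := hφ.2
    rw [Functor.map_comp]
    infer_instance

/-! ### "`Ψ` preserves `O^×(−)`" at every object, from a faithful 1-compatible `Ψ^bs` -/

section Units

variable (Ψ : C ≌ C) (Ψbs : D ⥤ D) (eΨ : Ψ.functor ⋙ 𝔉.base ≅ 𝔉.base ⋙ Ψbs)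
include eΨ

/-- `Ψ` maps units to units ("`Ψ` preserves '`O^×(−)`'", p.328 (PDF p.102); "the existence of `Ψ^bs`", p.334 (PDF p.108)),
from `Ψ ⋙ Base ≅ Base ⋙ Ψ^bs` (Thm. 4.4 (i): `Ψ` induces a 1-compatible `Ψ^bs`).
[cite: MochizukiEtTh2009, Thm 5.6 p.328 (PDF p.102)] -/
theorem mapAut_mem_units {S : C} {u : Aut S} (hu : u ∈ 𝔉.units S) :
    Ψ.functor.mapAut S u ∈ 𝔉.units (Ψ.functor.obj S) := by
  rw [𝔉.units_eq_ker, MonoidHom.mem_ker] at hu ⊢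
  apply Aut.ext
  have hb : 𝔉.base.map u.hom = 𝟙 _ := congrArg Iso.hom hu
  have hb' : (𝔉.base ⋙ Ψbs).map u.hom = 𝟙 _ := by
    change Ψbs.map (𝔉.base.map u.hom) = _
    rw [hb]
    exact CategoryTheory.Functor.map_id Ψbs _
  have hnat := NatIso.naturality_2 eΨ u.hom
  rw [hb', Category.id_comp, Iso.hom_inv_id_app] at hnat
  exact hnat.symm

/-- With `Ψ^bs` faithful, conversely: if `Ψ(u)` is a unit then so is `u`.
[cite: MochizukiEtTh2009, Thm 5.6 p.328 (PDF p.102)] -/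
theorem mem_units_of_mapAut_mem [Ψbs.Faithful] {S : C} {u : Aut S}
    (hu : Ψ.functor.mapAut S u ∈ 𝔉.units (Ψ.functor.obj S)) : u ∈ 𝔉.units S := by
  rw [𝔉.units_eq_ker, MonoidHom.mem_ker] at hu ⊢
  apply Aut.ext
  have hR : 𝔉.base.map (Ψ.functor.map u.hom) = 𝟙 _ := congrArg Iso.hom hu
  have h3 : eΨ.hom.app S ≫ (𝔉.base ⋙ Ψbs).map u.hom ≫ eΨ.inv.app S = 𝟙 _ :=
    (NatIso.naturality_2 eΨ u.hom).trans hR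
  have h4 : (𝔉.base ⋙ Ψbs).map u.hom ≫ eΨ.inv.app S = 𝟙 _ ≫ eΨ.inv.app S :=
    ((Iso.hom_comp_eq_id (eΨ.app S)).mp h3).trans (Category.id_comp _).symm
  have h5 : (𝔉.base ⋙ Ψbs).map u.hom = 𝟙 _ := (cancel_mono _).mp h4
  change 𝔉.base.map u.hom = 𝟙 _
  exact Ψbs.map_injective (h5.trans (CategoryTheory.Functor.map_id Ψbs _).symm)

/-- **`Ψ(O^×(S)) = O^×(Ψ(S))`** ([FrdI] Thm. 3.4 (iv) via Prop. 5.1, as cited on pp.328, 334 (PDF pp.102, 108)), here from a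
faithful 1-compatible `Ψ^bs`.  [cite: MochizukiEtTh2009, Thm 5.6 p.328 (PDF p.102)] -/
theorem units_map_mapAut [Ψbs.Faithful] (S : C) :
    (𝔉.units S).map (Ψ.functor.mapAut S) = 𝔉.units (Ψ.functor.obj S) := by
  ext v
  constructor
  · rintro ⟨u, hu, rfl⟩
    exact mapAut_mem_units Ψ Ψbs eΨ hu
  · intro hv
    refine ⟨(Ψ.fullyFaithfulFunctor.autMulEquivOfFullyFaithful S).symm v, ?_, ?_⟩
    · apply mem_units_of_mapAut_mem Ψ Ψbs eΨ
      change (Ψ.fullyFaithfulFunctor.autMulEquivOfFullyFaithful S)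
        ((Ψ.fullyFaithfulFunctor.autMulEquivOfFullyFaithful S).symm v) ∈ _
      rwa [MulEquiv.apply_symm_apply]
    · exact (Ψ.fullyFaithfulFunctor.autMulEquivOfFullyFaithful S).apply_symm_apply v

/-- `Ψ(μ_M(S)) = μ_M(Ψ(S))` (the cyclotomes, [FrdII] Def. 2.1 (i) / Def. 5.4). [cite: MochizukiEtTh2009, Thm 5.6 p.328 (PDF p.102)] -/
theorem muTorsion_map_mapAut [Ψbs.Faithful] (S : C) (M : ℕ) :
    (𝔉.muTorsion S M).map (Ψ.functor.mapAut S) = 𝔉.muTorsion (Ψ.functor.obj S) M := by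
  have hU := units_map_mapAut Ψ Ψbs eΨ S
  ext v
  constructor
  · intro hv
    obtain ⟨u, hu, rfl⟩ := Subgroup.mem_map.mp hv
    rw [mem_muTorsion] at hu ⊢
    exact ⟨mapAut_mem_units Ψ Ψbs eΨ hu.1, by rw [← map_pow, hu.2, map_one]⟩
  · intro hv
    rw [mem_muTorsion] at hv
    obtain ⟨u, hu, huv⟩ := Subgroup.mem_map.mp (hU.symm ▸ hv.1 :
      v ∈ (𝔉.units S).map (Ψ.functor.mapAut S))
    refine Subgroup.mem_map.mpr ⟨u, ?_, huv⟩
    rw [mem_muTorsion]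
    refine ⟨hu, ?_⟩
    have h1 : Ψ.functor.mapAut S (u ^ M) = 1 := by rw [map_pow, huv, hv.2]
    have h2 : Ψ.functor.mapAut S (u ^ M) = Ψ.functor.mapAut S 1 := by rw [h1, map_one]
    exact (Ψ.fullyFaithfulFunctor.autMulEquivOfFullyFaithful S).injective h2

/-- `Ψ` preserves `μ_M`-saturation (Def. 5.4 (a); [FrdII] Def. 2.1 (i)). [cite: MochizukiEtTh2009, Thm 5.6 p.328 (PDF p.102)] -/
theorem isMuSaturated_iff [Ψbs.Faithful] (S : C) (M : ℕ) :
    𝔉.IsMuSaturated S M ↔ 𝔉.IsMuSaturated (Ψ.functor.obj S) M := by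
  let E : 𝔉.muTorsion S M ≃* 𝔉.muTorsion (Ψ.functor.obj S) M :=
    ((Ψ.fullyFaithfulFunctor.autMulEquivOfFullyFaithful S).subgroupMap (𝔉.muTorsion S M)).trans
      (MulEquiv.subgroupCongr (muTorsion_map_mapAut Ψ Ψbs eΨ S M))
  exact ⟨fun ⟨f⟩ => ⟨E.symm.trans f⟩, fun ⟨f⟩ => ⟨E.trans f⟩⟩

/-- The unit transport `μ_N(S) ⥲ μ_N(Ψ(S))`, `u ↦ Ψ(u)`, for all `S` at once (packaged existentially).
[cite: MochizukiEtTh2009, Thm 5.6 p.328 (PDF p.102)] -/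
theorem exists_muTorsionEquiv [Ψbs.Faithful] (M : ℕ) :
    ∃ μE : ∀ S : C, 𝔉.muTorsion S M ≃* 𝔉.muTorsion (Ψ.functor.obj S) M,
      ∀ (S : C) (w : 𝔉.muTorsion S M),
        ((μE S w : 𝔉.muTorsion (Ψ.functor.obj S) M) : Aut (Ψ.functor.obj S)) =
          Ψ.functor.mapAut S (w : Aut S) :=
  ⟨fun S => ((Ψ.fullyFaithfulFunctor.autMulEquivOfFullyFaithful S).subgroupMap
      (𝔉.muTorsion S M)).trans (MulEquiv.subgroupCongr (muTorsion_map_mapAut Ψ Ψbs eΨ S M)),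
    fun _ _ => rfl⟩

end Units

end ThetaFrobenioid

end Literature.AnabelianGeometry.EtaleTheta
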